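import Summits.ResolutionOfSingularities.ResolutionOfSingularities.Theorems.DeltaCutGradeCertificates2
import HarnessLib

/-!
# DeltaCutGradeCertificates3 — decomp-res node «GradeCut (certificates)» (lens-6 g28, critic row 210 CLEARED), tree
file 3/5 of the node

Content VERBATIM from the decomp-res lens-6 g28 certificate files
`HOME/decomp-res-lens-6/g28/GradeCutCertificates.lean` (92912ba2) + `GradeCutCertificates2.lean` (5886ffab) (ring
level, import the landed `DeltaCutRefCertificates3`; namespace `…Theorems.DeltaCutClasses`, sections
`GCertificatesA/B/C`); HOME = run/shared/lean/pub/decomp-res; critic CRITIC-LEDGER row 210 CLEARED; landing orders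
NEXT-g29.md §4 (B)/(C) + INBOX 11:01:55Z — provenance, critic text and the first lens header in full in
`DeltaCutGradeCertificates`.  `--kind proof --supports stmt-ResolutionOfSingularities-26971`.

## This file

Continuation 3/5 of `DeltaCutGradeCertificates` (same namespace / sections of the node, cut at the tree's 400-line
cap; section variables / opens replayed): scopes `GCertificatesB`, `GCertificatesC` — carries `G0_L1_top`,
`G0_L1_line`, `G0_L1_oldLines`, `G0_L1_tame_M`, `G0_L1_tame_M'`, `G0_L1_symm`, `G0_G1_certificate`,
`G0_B_lineCharts`, `G0_B_chart_z_noTop`.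

[WRITER NOTE (decomp-res writer g13): file split only (tree files ≤ 400 lines, cut at declaration boundaries; the
two lens files form one linear chain); namespace, the sections `GCertificatesA/B/C` with their `open MvPolynomial` /
`variable {K : Type*} [Field K]`, and every declaration exactly as in the lens (the HOME-only dupNamespace-linter
lines are dropped — the library sets it; `noncomputable section`, the file-level `open` lines, `universe u` and
`open …Rescue.BedZpeBinom4Centre (mul_mem_pow_add)` are replayed in every part).]

(Sources: Hironaka1967; CossartJannsenSaito2020 Def. 3.13 / Thm. 3.14, Ch. 5–8; CossartPiltant2019 Prop. 2.6;
Giraud1975; EGAIV4 §16–§18; StacksProject 0804 / 0BIQ / 035A; Matsumura1987 §28–§31; Kollar2007 §3.)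
-/

noncomputable section

open CategoryTheory CategoryTheory.Limits AlgebraicGeometry TopologicalSpace IsLocalRing
open Literature.AlgebraicGeometry.Resolution

universe u

open Summit.ResolutionOfSingularities.ResolutionOfSingularities.Theorems.Rescue.BedZpeBinom4Centre (mul_mem_pow_add)

namespace Summit.ResolutionOfSingularities.ResolutionOfSingularities.Theorems.DeltaCutClasses

open Summit.ResolutionOfSingularities.ResolutionOfSingularities.Theorems.TwistCutClasses
open Summit.ResolutionOfSingularities.ResolutionOfSingularities.Theorems.LightCutClasses

section GCertificatesB

open MvPolynomial
variable {K : Type*} [Field K]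

/-! #### Level 1, chart `t`: `F₁ = z'³ + t·u²·w²` (coordinates `0 = z', 1 = t, 2 = u, 3 = w`; `V(t)` = the exceptional plane) -/

/-- **LEVEL 1 — THE TOP LOCUS lies in `L₁ ∪ M ∪ M′`**, `L₁ = V(z',u,w)`, `M = V(z',t,u)`, `M′ = V(z',t,w)`: a prime
of order `≥ 3`
contains `z'`, `u` or `w` (`∂_t F₁ = u²w²`), `t` or `w` (`∂_u∂_u F₁ = 2t·w²`), and `t` or `u` (`∂_w∂_w F₁ = 2t·u²`)
— in particular the
exceptional plane `V(z',t)` is NOT in the top locus (generic order `1`). [new; elementary] [folklore] -/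
theorem G0_L1_top [CharP K 3] (𝔮 : Ideal (MvPolynomial (Fin 4) K)) [𝔮.IsPrime] {s : MvPolynomial (Fin 4) K} (hs : s ∉ 𝔮)
    (h : s * (X 0 ^ 3 + X 1 * X 2 ^ 2 * X 3 ^ 2 : MvPolynomial (Fin 4) K) ∈ 𝔮 ^ 3) :
    (X 0 : MvPolynomial (Fin 4) K) ∈ 𝔮 ∧
      ((X 2 : MvPolynomial (Fin 4) K) ∈ 𝔮 ∨ (X 3 : MvPolynomial (Fin 4) K) ∈ 𝔮) ∧
      ((X 1 : MvPolynomial (Fin 4) K) ∈ 𝔮 ∨ (X 3 : MvPolynomial (Fin 4) K) ∈ 𝔮) ∧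
      ((X 1 : MvPolynomial (Fin 4) K) ∈ 𝔮 ∨ (X 2 : MvPolynomial (Fin 4) K) ∈ 𝔮) := by
  have hP := ‹𝔮.IsPrime›
  have hs2 : s ^ 2 ∉ 𝔮 := pow_not_mem 𝔮 hs 2
  have hs4 : (s ^ 2) ^ 2 ∉ 𝔮 := pow_not_mem 𝔮 hs2 2
  have h2 : (2 : MvPolynomial (Fin 4) K) ∉ 𝔮 := two_not_mem (K := K) 𝔮
  have e10 := f_ne K (i := 1) (j := 0) (by decide)
  have e11 := f_self K 1
  have e12 := f_ne K (i := 1) (j := 2) (by decide)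
  have e13 := f_ne K (i := 1) (j := 3) (by decide)
  have e20 := f_ne K (i := 2) (j := 0) (by decide)
  have e21 := f_ne K (i := 2) (j := 1) (by decide)
  have e22 := f_self K 2
  have e23 := f_ne K (i := 2) (j := 3) (by decide)
  have e30 := f_ne K (i := 3) (j := 0) (by decide)
  have e31 := f_ne K (i := 3) (j := 1) (by decide)
  have e32 := f_ne K (i := 3) (j := 2) (by decide)
  have e33 := f_self K 3
  have d1 : pderiv 1 (X 0 ^ 3 + X 1 * X 2 ^ 2 * X 3 ^ 2 : MvPolynomial (Fin 4) K) = 1 * (X 2 * X 3) ^ 2 := by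
    simp only [map_add, Derivation.leibniz, Derivation.leibniz_pow, smul_eq_mul, nsmul_eq_mul, e10, e11, e12, e13]
    push_cast; ring
  have d2 : pderiv 2 (X 0 ^ 3 + X 1 * X 2 ^ 2 * X 3 ^ 2 : MvPolynomial (Fin 4) K) = 2 * (X 1 * X 2 * X 3 ^ 2) := by
    simp only [map_add, Derivation.leibniz, Derivation.leibniz_pow, smul_eq_mul, nsmul_eq_mul, e20, e21, e22, e23]
    push_cast; ring
  have dd2 : pderiv 2 (2 * (X 1 * X 2 * X 3 ^ 2) : MvPolynomial (Fin 4) K) = 2 * (X 1 * X 3 ^ 2) ^ 1 := by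
    simp only [Derivation.leibniz, Derivation.leibniz_pow, smul_eq_mul, nsmul_eq_mul, e21, e22, e23, f_two]
    push_cast; ring
  have d3 : pderiv 3 (X 0 ^ 3 + X 1 * X 2 ^ 2 * X 3 ^ 2 : MvPolynomial (Fin 4) K) = 2 * (X 1 * X 2 ^ 2 * X 3) := by
    simp only [map_add, Derivation.leibniz, Derivation.leibniz_pow, smul_eq_mul, nsmul_eq_mul, e30, e31, e32, e33]
    push_cast; ring
  have dd3 : pderiv 3 (2 * (X 1 * X 2 ^ 2 * X 3) : MvPolynomial (Fin 4) K) = 2 * (X 1 * X 2 ^ 2) ^ 1 := by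
    simp only [Derivation.leibniz, Derivation.leibniz_pow, smul_eq_mul, nsmul_eq_mul, e31, e32, e33, f_two]
    push_cast; ring
  have h1 := sq_mul_deriv_mem_pow 𝔮 h (pderiv 1)
  rw [d1] at h1
  have huw : (X 2 * X 3 : MvPolynomial (Fin 4) K) ∈ 𝔮 := mem_of_mul_mul_pow_mem_pow 𝔮 two_ne_zero hs2 (one_not_mem_of_isPrime 𝔮) h1
  have h12 := sq_mul_deriv_mem_pow 𝔮 h (pderiv 2)
  rw [d2] at h12
  have h22 := sq_mul_deriv_mem_pow 𝔮 h12 (pderiv 2)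
  rw [dd2] at h22
  have hA : (X 1 * X 3 ^ 2 : MvPolynomial (Fin 4) K) ∈ 𝔮 := mem_of_mul_mul_pow_mem_pow 𝔮 one_ne_zero hs4 h2 h22
  have h13 := sq_mul_deriv_mem_pow 𝔮 h (pderiv 3)
  rw [d3] at h13
  have h33 := sq_mul_deriv_mem_pow 𝔮 h13 (pderiv 3)
  rw [dd3] at h33
  have hB : (X 1 * X 2 ^ 2 : MvPolynomial (Fin 4) K) ∈ 𝔮 := mem_of_mul_mul_pow_mem_pow 𝔮 one_ne_zero hs4 h2 h33
  have huw' : (X 2 : MvPolynomial (Fin 4) K) ∈ 𝔮 ∨ (X 3 : MvPolynomial (Fin 4) K) ∈ 𝔮 := hP.mem_or_mem huw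
  have htw : (X 1 : MvPolynomial (Fin 4) K) ∈ 𝔮 ∨ (X 3 : MvPolynomial (Fin 4) K) ∈ 𝔮 :=
    (hP.mem_or_mem hA).imp id fun h' => hP.mem_of_pow_mem 2 h'
  have htu : (X 1 : MvPolynomial (Fin 4) K) ∈ 𝔮 ∨ (X 2 : MvPolynomial (Fin 4) K) ∈ 𝔮 :=
    (hP.mem_or_mem hB).imp id fun h' => hP.mem_of_pow_mem 2 h'
  have hf : (X 0 ^ 3 + X 1 * X 2 ^ 2 * X 3 ^ 2 : MvPolynomial (Fin 4) K) ∈ 𝔮 := mem_of_sMul_mem_cube 𝔮 hs h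
  have hr : (X 1 * X 2 ^ 2 * X 3 ^ 2 : MvPolynomial (Fin 4) K) ∈ 𝔮 := by
    rcases huw' with hu | hw
    · exact Ideal.mul_mem_right _ _ (Ideal.mul_mem_left _ _ (Ideal.pow_mem_of_mem 𝔮 hu 2 (by norm_num)))
    · exact Ideal.mul_mem_left _ _ (Ideal.pow_mem_of_mem 𝔮 hw 2 (by norm_num))
  have h0 : (X 0 : MvPolynomial (Fin 4) K) ^ 3 ∈ 𝔮 := by
    have := Ideal.sub_mem _ hf hr
    rwa [add_sub_cancel_right] at this
  exact ⟨hP.mem_of_pow_mem 3 h0, huw', htw, htu⟩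

/-- **LEVEL 1 — THE LINE `L₁ = V(z',u,w)` (strict transform of `L`) lies in the top locus** (`F₁ ∈ L₁³`), is a LINE
(`t ∉ L₁`), is
WILD at every point (`t·u²w² ∈ L₁⁴`: the 3-power form `z'³ + L₁⁴`), and every closed point `c = (0, c₁, 0, 0)` of it
has a NEAR point
(chart `u` of the point blow-up at `c`: the transform `z″³ + u·H·w'²`, `H = c₁ + τ'u`, lies in `𝔫'³` for EVERY
cofactor `H`): bad₁ `⊇`
all closed points of `L₁`. [new; elementary] [folklore] -/
theorem G0_L1_line :
    (X 0 ^ 3 + X 1 * X 2 ^ 2 * X 3 ^ 2 : MvPolynomial (Fin 4) K) ∈ (Ideal.span {(X 0 : MvPolynomial (Fin 4) K), X 2, X 3}) ^ 3 ∧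
      (X 1 : MvPolynomial (Fin 4) K) ∉ Ideal.span {(X 0 : MvPolynomial (Fin 4) K), X 2, X 3} ∧
      (X 1 * X 2 ^ 2 * X 3 ^ 2 : MvPolynomial (Fin 4) K) ∈ (Ideal.span {(X 0 : MvPolynomial (Fin 4) K), X 2, X 3}) ^ 4 ∧
      ∀ H : MvPolynomial (Fin 4) K, (X 0 ^ 3 + X 2 * (H * X 3 ^ 2) : MvPolynomial (Fin 4) K) ∈
        (Ideal.span {(X 0 : MvPolynomial (Fin 4) K), X 1, X 2, X 3}) ^ 3 := by
  have hX0 : (X 0 : MvPolynomial (Fin 4) K) ∈ Ideal.span {(X 0 : MvPolynomial (Fin 4) K), X 2, X 3} := Ideal.subset_span (by simp)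
  have hX2 : (X 2 : MvPolynomial (Fin 4) K) ∈ Ideal.span {(X 0 : MvPolynomial (Fin 4) K), X 2, X 3} := Ideal.subset_span (by simp)
  have hX3 : (X 3 : MvPolynomial (Fin 4) K) ∈ Ideal.span {(X 0 : MvPolynomial (Fin 4) K), X 2, X 3} := Ideal.subset_span (by simp)
  have h22 : (X 2 ^ 2 * X 3 ^ 2 : MvPolynomial (Fin 4) K) ∈ (Ideal.span {(X 0 : MvPolynomial (Fin 4) K), X 2, X 3}) ^ (2 + 2) :=
    mul_mem_pow_add (Ideal.pow_mem_pow hX2 2) (Ideal.pow_mem_pow hX3 2)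
  have hr : (X 1 * X 2 ^ 2 * X 3 ^ 2 : MvPolynomial (Fin 4) K) ∈ (Ideal.span {(X 0 : MvPolynomial (Fin 4) K), X 2, X 3}) ^ 4 := by
    have := Ideal.mul_mem_left _ (X 1) h22
    rwa [show (X 1 * (X 2 ^ 2 * X 3 ^ 2) : MvPolynomial (Fin 4) K) = X 1 * X 2 ^ 2 * X 3 ^ 2 by ring] at this
  refine ⟨Ideal.add_mem _ (Ideal.pow_mem_pow hX0 3) (Ideal.pow_le_pow_right (by norm_num) hr), ?_, hr, fun H => ?_⟩
  · refine not_mem_span_of_eval _ (fun i => if i = 1 then 1 else 0) ?_ (by simp)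
    intro g hg
    simp only [Set.mem_insert_iff, Set.mem_singleton_iff] at hg
    rcases hg with rfl | rfl | rfl <;> simp
  · refine Ideal.add_mem _ (Ideal.pow_mem_pow (X_mem_spanX4 0) 3) ?_
    have h3 : (X 2 * X 3 ^ 2 : MvPolynomial (Fin 4) K) ∈ (Ideal.span {(X 0 : MvPolynomial (Fin 4) K), X 1, X 2, X 3}) ^ (1 + 2) :=
      mul_mem_pow_add (by rw [pow_one]; exact X_mem_spanX4 2) (Ideal.pow_mem_pow (X_mem_spanX4 3) 2)
    have := Ideal.mul_mem_left _ H h3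
    rwa [show (H * (X 2 * X 3 ^ 2) : MvPolynomial (Fin 4) K) = X 2 * (H * X 3 ^ 2) by ring] at this

/-- **LEVEL 1 — THE TWO EXCEPTIONAL LINES `M = V(z',t,u)` AND `M′ = V(z',t,w)` lie in the top locus** (`F₁ ∈ M³`,
`F₁ ∈ M′³`), are LINES
(`w ∉ M`, `u ∉ M′`) and meet each other (and `L₁`) at the origin only (`M ⊔ M′ = 𝔫₀`).  Together with `G0_L1_top`:
top₁ `= L₁ ∪ M ∪ M′`;
with `G0_L1_tame_M/M'`: closure bad₁ `= L₁`, and the old top locus off it is `(M ∪ M′) ∖ {0}`. [new; elementary] [folklore] -/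
theorem G0_L1_oldLines :
    (X 0 ^ 3 + X 1 * X 2 ^ 2 * X 3 ^ 2 : MvPolynomial (Fin 4) K) ∈ (Ideal.span {(X 0 : MvPolynomial (Fin 4) K), X 1, X 2}) ^ 3 ∧
      (X 0 ^ 3 + X 1 * X 2 ^ 2 * X 3 ^ 2 : MvPolynomial (Fin 4) K) ∈ (Ideal.span {(X 0 : MvPolynomial (Fin 4) K), X 1, X 3}) ^ 3 ∧
      (X 3 : MvPolynomial (Fin 4) K) ∉ Ideal.span {(X 0 : MvPolynomial (Fin 4) K), X 1, X 2} ∧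
      (X 2 : MvPolynomial (Fin 4) K) ∉ Ideal.span {(X 0 : MvPolynomial (Fin 4) K), X 1, X 3} ∧
      Ideal.span {(X 0 : MvPolynomial (Fin 4) K), X 1, X 2} ⊔ Ideal.span {(X 0 : MvPolynomial (Fin 4) K), X 1, X 3} =
        Ideal.span {(X 0 : MvPolynomial (Fin 4) K), X 1, X 2, X 3} := by
  have hM0 : (X 0 : MvPolynomial (Fin 4) K) ∈ Ideal.span {(X 0 : MvPolynomial (Fin 4) K), X 1, X 2} := Ideal.subset_span (by simp)
  have hM1 : (X 1 : MvPolynomial (Fin 4) K) ∈ Ideal.span {(X 0 : MvPolynomial (Fin 4) K), X 1, X 2} := Ideal.subset_span (by simp)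
  have hM2 : (X 2 : MvPolynomial (Fin 4) K) ∈ Ideal.span {(X 0 : MvPolynomial (Fin 4) K), X 1, X 2} := Ideal.subset_span (by simp)
  have hN0 : (X 0 : MvPolynomial (Fin 4) K) ∈ Ideal.span {(X 0 : MvPolynomial (Fin 4) K), X 1, X 3} := Ideal.subset_span (by simp)
  have hN1 : (X 1 : MvPolynomial (Fin 4) K) ∈ Ideal.span {(X 0 : MvPolynomial (Fin 4) K), X 1, X 3} := Ideal.subset_span (by simp)
  have hN3 : (X 3 : MvPolynomial (Fin 4) K) ∈ Ideal.span {(X 0 : MvPolynomial (Fin 4) K), X 1, X 3} := Ideal.subset_span (by simp)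
  refine ⟨?_, ?_, ?_, ?_, ?_⟩
  · refine Ideal.add_mem _ (Ideal.pow_mem_pow hM0 3) ?_
    have h12 : (X 1 * X 2 ^ 2 : MvPolynomial (Fin 4) K) ∈ (Ideal.span {(X 0 : MvPolynomial (Fin 4) K), X 1, X 2}) ^ (1 + 2) :=
      mul_mem_pow_add (by rw [pow_one]; exact hM1) (Ideal.pow_mem_pow hM2 2)
    exact Ideal.mul_mem_right _ _ h12
  · refine Ideal.add_mem _ (Ideal.pow_mem_pow hN0 3) ?_
    have h1 : (X 1 * X 2 ^ 2 : MvPolynomial (Fin 4) K) ∈ (Ideal.span {(X 0 : MvPolynomial (Fin 4) K), X 1, X 3}) ^ 1 := by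
      rw [pow_one]; exact Ideal.mul_mem_right _ _ hN1
    exact mul_mem_pow_add h1 (Ideal.pow_mem_pow hN3 2)
  · refine not_mem_span_of_eval _ (fun i => if i = 3 then 1 else 0) ?_ (by simp)
    intro g hg
    simp only [Set.mem_insert_iff, Set.mem_singleton_iff] at hg
    rcases hg with rfl | rfl | rfl <;> simp
  · refine not_mem_span_of_eval _ (fun i => if i = 2 then 1 else 0) ?_ (by simp)
    intro g hg
    simp only [Set.mem_insert_iff, Set.mem_singleton_iff] at hg
    rcases hg with rfl | rfl | rfl <;> simp
  · apply le_antisymm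
    · refine sup_le (Ideal.span_le.2 ?_) (Ideal.span_le.2 ?_)
      · intro g hg
        simp only [Set.mem_insert_iff, Set.mem_singleton_iff] at hg
        rcases hg with rfl | rfl | rfl
        exacts [X_mem_spanX4 0, X_mem_spanX4 1, X_mem_spanX4 2]
      · intro g hg
        simp only [Set.mem_insert_iff, Set.mem_singleton_iff] at hg
        rcases hg with rfl | rfl | rfl
        exacts [X_mem_spanX4 0, X_mem_spanX4 1, X_mem_spanX4 3]
    · refine Ideal.span_le.2 ?_
      intro g hg
      simp only [Set.mem_insert_iff, Set.mem_singleton_iff] at hg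
      rcases hg with rfl | rfl | rfl | rfl
      · exact Ideal.mem_sup_left hM0
      · exact Ideal.mem_sup_left hM1
      · exact Ideal.mem_sup_left hM2
      · exact Ideal.mem_sup_right hN3

/-- **LEVEL 1 — `M = V(z',t,u)` IS TAME off the origin** («`z³ + c·t·u²` is not a cube», certified): at a prime `𝔫 ∋
t` with `w ∉ 𝔫`
(every point of `M ∖ L₁ = M ∖ {0}`), the order-2 operator `∂_u∂_u` extracts `∂_u∂_u F₁ = (2w²)·t` with `2w² ∉ 𝔫` and
`t ∈ 𝔫` a REGULAR
PARAMETER (`s'·t ∉ 𝔫²` for `s' ∉ 𝔫`): absolute contact — NOT bad. [new; elementary] [folklore] -/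
theorem G0_L1_tame_M [CharP K 3] (𝔫 : Ideal (MvPolynomial (Fin 4) K)) [𝔫.IsPrime] (h1 : (X 1 : MvPolynomial (Fin 4) K) ∈ 𝔫)
    (h3 : (X 3 : MvPolynomial (Fin 4) K) ∉ 𝔫) :
    (pderiv 2) ((pderiv 2) (X 0 ^ 3 + X 1 * X 2 ^ 2 * X 3 ^ 2 : MvPolynomial (Fin 4) K)) = 2 * X 3 ^ 2 * X 1 ∧
      (2 * X 3 ^ 2 : MvPolynomial (Fin 4) K) ∉ 𝔫 ∧
      ∀ s' ∉ 𝔫, s' * (X 1 : MvPolynomial (Fin 4) K) ∉ 𝔫 ^ 2 := by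
  have e20 := f_ne K (i := 2) (j := 0) (by decide)
  have e21 := f_ne K (i := 2) (j := 1) (by decide)
  have e22 := f_self K 2
  have e23 := f_ne K (i := 2) (j := 3) (by decide)
  have d2 : pderiv 2 (X 0 ^ 3 + X 1 * X 2 ^ 2 * X 3 ^ 2 : MvPolynomial (Fin 4) K) = 2 * (X 1 * X 2 * X 3 ^ 2) := by
    simp only [map_add, Derivation.leibniz, Derivation.leibniz_pow, smul_eq_mul, nsmul_eq_mul, e20, e21, e22, e23]
    push_cast; ring
  have dd2 : pderiv 2 (2 * (X 1 * X 2 * X 3 ^ 2) : MvPolynomial (Fin 4) K) = 2 * X 3 ^ 2 * X 1 := by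
    simp only [Derivation.leibniz, Derivation.leibniz_pow, smul_eq_mul, nsmul_eq_mul, e21, e22, e23, f_two]
    push_cast; ring
  refine ⟨by rw [d2, dd2], fun hmem => ?_, fun s' hs' hmem => sMul_not_mem_sq_of_pderiv_eq_one 𝔫 1 h1 (f_self K 1) hs' hmem⟩
  rcases ‹𝔫.IsPrime›.mem_or_mem hmem with h | h
  · exact two_not_mem (K := K) 𝔫 h
  · exact h3 (‹𝔫.IsPrime›.mem_of_pow_mem 2 h)

/-- **LEVEL 1 — `M′ = V(z',t,w)` IS TAME off the origin**: at a prime `𝔫 ∋ t` with `u ∉ 𝔫`, `∂_w∂_w F₁ = (2u²)·t`,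
`2u² ∉ 𝔫`, `t` a
regular parameter. [new; elementary] [folklore] -/
theorem G0_L1_tame_M' [CharP K 3] (𝔫 : Ideal (MvPolynomial (Fin 4) K)) [𝔫.IsPrime] (h1 : (X 1 : MvPolynomial (Fin 4) K) ∈ 𝔫)
    (h2 : (X 2 : MvPolynomial (Fin 4) K) ∉ 𝔫) :
    (pderiv 3) ((pderiv 3) (X 0 ^ 3 + X 1 * X 2 ^ 2 * X 3 ^ 2 : MvPolynomial (Fin 4) K)) = 2 * X 2 ^ 2 * X 1 ∧
      (2 * X 2 ^ 2 : MvPolynomial (Fin 4) K) ∉ 𝔫 ∧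
      ∀ s' ∉ 𝔫, s' * (X 1 : MvPolynomial (Fin 4) K) ∉ 𝔫 ^ 2 := by
  have e30 := f_ne K (i := 3) (j := 0) (by decide)
  have e31 := f_ne K (i := 3) (j := 1) (by decide)
  have e32 := f_ne K (i := 3) (j := 2) (by decide)
  have e33 := f_self K 3
  have d3 : pderiv 3 (X 0 ^ 3 + X 1 * X 2 ^ 2 * X 3 ^ 2 : MvPolynomial (Fin 4) K) = 2 * (X 1 * X 2 ^ 2 * X 3) := by
    simp only [map_add, Derivation.leibniz, Derivation.leibniz_pow, smul_eq_mul, nsmul_eq_mul, e30, e31, e32, e33]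
    push_cast; ring
  have dd3 : pderiv 3 (2 * (X 1 * X 2 ^ 2 * X 3) : MvPolynomial (Fin 4) K) = 2 * X 2 ^ 2 * X 1 := by
    simp only [Derivation.leibniz, Derivation.leibniz_pow, smul_eq_mul, nsmul_eq_mul, e31, e32, e33, f_two]
    push_cast; ring
  refine ⟨by rw [d3, dd3], fun hmem => ?_, fun s' hs' hmem => sMul_not_mem_sq_of_pderiv_eq_one 𝔫 1 h1 (f_self K 1) hs' hmem⟩
  rcases ‹𝔫.IsPrime›.mem_or_mem hmem with h | h
  · exact two_not_mem (K := K) 𝔫 h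
  · exact h2 (‹𝔫.IsPrime›.mem_of_pow_mem 2 h)

/-- **`F₁` is symmetric under `u ↔ w`** (so every chart-`w` statement below is the chart-`u` statement with `2 ↔
3`). [elementary]
[folklore] -/
theorem G0_L1_symm :
    rename (Equiv.swap (2 : Fin 4) 3) (X 0 ^ 3 + X 1 * X 2 ^ 2 * X 3 ^ 2 : MvPolynomial (Fin 4) K) =
      X 0 ^ 3 + X 1 * X 2 ^ 2 * X 3 ^ 2 := by
  simp [rename_X, Equiv.swap_apply_def]; ring

/-- **G₀ — THE LEVEL 0 → 1 / LEVEL 1 CERTIFICATE** (pricing (g6), levels 0 and 1): both charts of the blow-up of `P`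
(`G0_A_charts`), the
`z`-chart EMPTY of top points (`G0_A_chart_z_noTop`); in chart `t`: top₁ `⊆ L₁ ∪ M ∪ M′` (`G0_L1_top`) and `⊇` (`G0_L1_line`,
`G0_L1_oldLines`), `L₁` WILD with NEAR points (bad), `M`, `M′` TAME off the origin (`G0_L1_tame_M/M'`), `M ⊔ M′ =
𝔫₀`: closure bad₁ `= L₁`
REGULAR — the level is separating-ACTIVE and the old top locus off the bad closure is `(M ∪ M′) ∖ {0}`. [new] [folklore] -/
theorem G0_G1_certificate [CharP K 3] :
    -- (L) the two charts of the blow-up of P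
    (aeval (linChartSubst (K := K) {0, 1} 1) (X 0 ^ 3 + X 1 ^ 4 * X 2 ^ 2 * X 3 ^ 2 : MvPolynomial (Fin 4) K) =
        X 1 ^ 3 * (X 0 ^ 3 + X 1 * X 2 ^ 2 * X 3 ^ 2) ∧
      aeval (linChartSubst (K := K) {0, 1} 0) (X 0 ^ 3 + X 1 ^ 4 * X 2 ^ 2 * X 3 ^ 2 : MvPolynomial (Fin 4) K) =
        X 0 ^ 3 * (1 + X 0 * X 1 ^ 4 * X 2 ^ 2 * X 3 ^ 2)) ∧
    -- chart z: no top point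
      (∀ (𝔮 : Ideal (MvPolynomial (Fin 4) K)) [𝔮.IsPrime], ∀ s ∉ 𝔮,
        s * (1 + X 0 * X 1 ^ 4 * X 2 ^ 2 * X 3 ^ 2 : MvPolynomial (Fin 4) K) ∈ 𝔮 ^ 3 → False) ∧
    -- chart t: top ⊆ L₁ ∪ M ∪ M′
      (∀ (𝔮 : Ideal (MvPolynomial (Fin 4) K)) [𝔮.IsPrime], ∀ s ∉ 𝔮,
        s * (X 0 ^ 3 + X 1 * X 2 ^ 2 * X 3 ^ 2 : MvPolynomial (Fin 4) K) ∈ 𝔮 ^ 3 →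
          (X 0 : MvPolynomial (Fin 4) K) ∈ 𝔮 ∧
            ((X 2 : MvPolynomial (Fin 4) K) ∈ 𝔮 ∨ (X 3 : MvPolynomial (Fin 4) K) ∈ 𝔮) ∧
            ((X 1 : MvPolynomial (Fin 4) K) ∈ 𝔮 ∨ (X 3 : MvPolynomial (Fin 4) K) ∈ 𝔮) ∧
            ((X 1 : MvPolynomial (Fin 4) K) ∈ 𝔮 ∨ (X 2 : MvPolynomial (Fin 4) K) ∈ 𝔮)) ∧
    -- L₁: top, line, wild, near
      ((X 0 ^ 3 + X 1 * X 2 ^ 2 * X 3 ^ 2 : MvPolynomial (Fin 4) K) ∈ (Ideal.span {(X 0 : MvPolynomial (Fin 4) K), X 2, X 3}) ^ 3 ∧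
        (X 1 : MvPolynomial (Fin 4) K) ∉ Ideal.span {(X 0 : MvPolynomial (Fin 4) K), X 2, X 3} ∧
        (X 1 * X 2 ^ 2 * X 3 ^ 2 : MvPolynomial (Fin 4) K) ∈ (Ideal.span {(X 0 : MvPolynomial (Fin 4) K), X 2, X 3}) ^ 4 ∧
        ∀ H : MvPolynomial (Fin 4) K, (X 0 ^ 3 + X 2 * (H * X 3 ^ 2) : MvPolynomial (Fin 4) K) ∈
          (Ideal.span {(X 0 : MvPolynomial (Fin 4) K), X 1, X 2, X 3}) ^ 3) ∧
    -- M, M′: top, lines, crossing at the origin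
      ((X 0 ^ 3 + X 1 * X 2 ^ 2 * X 3 ^ 2 : MvPolynomial (Fin 4) K) ∈ (Ideal.span {(X 0 : MvPolynomial (Fin 4) K), X 1, X 2}) ^ 3 ∧
        (X 0 ^ 3 + X 1 * X 2 ^ 2 * X 3 ^ 2 : MvPolynomial (Fin 4) K) ∈ (Ideal.span {(X 0 : MvPolynomial (Fin 4) K), X 1, X 3}) ^ 3 ∧
        (X 3 : MvPolynomial (Fin 4) K) ∉ Ideal.span {(X 0 : MvPolynomial (Fin 4) K), X 1, X 2} ∧
        (X 2 : MvPolynomial (Fin 4) K) ∉ Ideal.span {(X 0 : MvPolynomial (Fin 4) K), X 1, X 3} ∧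
        Ideal.span {(X 0 : MvPolynomial (Fin 4) K), X 1, X 2} ⊔ Ideal.span {(X 0 : MvPolynomial (Fin 4) K), X 1, X 3} =
          Ideal.span {(X 0 : MvPolynomial (Fin 4) K), X 1, X 2, X 3}) ∧
    -- M tame off the origin
      (∀ (𝔫 : Ideal (MvPolynomial (Fin 4) K)) [𝔫.IsPrime], (X 1 : MvPolynomial (Fin 4) K) ∈ 𝔫 → (X 3 : MvPolynomial (Fin 4) K) ∉ 𝔫 →
        (pderiv 2) ((pderiv 2) (X 0 ^ 3 + X 1 * X 2 ^ 2 * X 3 ^ 2 : MvPolynomial (Fin 4) K)) = 2 * X 3 ^ 2 * X 1 ∧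
          (2 * X 3 ^ 2 : MvPolynomial (Fin 4) K) ∉ 𝔫 ∧ ∀ s' ∉ 𝔫, s' * (X 1 : MvPolynomial (Fin 4) K) ∉ 𝔫 ^ 2) ∧
    -- M′ tame off the origin
      (∀ (𝔫 : Ideal (MvPolynomial (Fin 4) K)) [𝔫.IsPrime], (X 1 : MvPolynomial (Fin 4) K) ∈ 𝔫 → (X 2 : MvPolynomial (Fin 4) K) ∉ 𝔫 →
        (pderiv 3) ((pderiv 3) (X 0 ^ 3 + X 1 * X 2 ^ 2 * X 3 ^ 2 : MvPolynomial (Fin 4) K)) = 2 * X 2 ^ 2 * X 1 ∧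
          (2 * X 2 ^ 2 : MvPolynomial (Fin 4) K) ∉ 𝔫 ∧ ∀ s' ∉ 𝔫, s' * (X 1 : MvPolynomial (Fin 4) K) ∉ 𝔫 ^ 2) :=
  ⟨G0_A_charts, fun 𝔮 _ _ hs h => G0_A_chart_z_noTop 𝔮 hs h, fun 𝔮 _ _ hs h => G0_L1_top 𝔮 hs h, G0_L1_line, G0_L1_oldLines,
    fun 𝔫 _ h1 h3 => G0_L1_tame_M 𝔫 h1 h3, fun 𝔫 _ h1 h2 => G0_L1_tame_M' 𝔫 h1 h2⟩

end GCertificatesB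

section GCertificatesC

open MvPolynomial
variable {K : Type*} [Field K]

/-! ### §GCertificatesC — G₀, THE SEPARATING HOP AT LEVEL 1 (step 1 along `L₁`, all three charts; step 2 along `M̃ ⊔
M̃′`, all charts)
AND LEVEL 2: bad₂ = ∅ -/

/-- **STEP 1: THE THREE REES CHARTS of the blow-up of `L₁ = V(z',u,w)`** (`linChartSubst {0,2,3} e`): chart `u`: `F₁
= u³·(z″³ + t·u·w″²)`;
chart `w`: `F₁ = w³·(z″³ + t·u″²·w)` (g26's P∞ `z³ + s·u²·w` LITERALLY, `s = t`); chart `z'`: `F₁ = z'³·(1 +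
z'·t·u″²·w″²)`. [new; elementary]
[folklore] -/
theorem G0_B_lineCharts :
    aeval (linChartSubst (K := K) {0, 2, 3} 2) (X 0 ^ 3 + X 1 * X 2 ^ 2 * X 3 ^ 2 : MvPolynomial (Fin 4) K) =
        X 2 ^ 3 * (X 0 ^ 3 + X 1 * X 2 * X 3 ^ 2) ∧
      aeval (linChartSubst (K := K) {0, 2, 3} 3) (X 0 ^ 3 + X 1 * X 2 ^ 2 * X 3 ^ 2 : MvPolynomial (Fin 4) K) =
        X 3 ^ 3 * (X 0 ^ 3 + X 1 * X 2 ^ 2 * X 3) ∧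
      aeval (linChartSubst (K := K) {0, 2, 3} 0) (X 0 ^ 3 + X 1 * X 2 ^ 2 * X 3 ^ 2 : MvPolynomial (Fin 4) K) =
        X 0 ^ 3 * (1 + X 0 * X 1 * X 2 ^ 2 * X 3 ^ 2) := by
  refine ⟨?_, ?_, ?_⟩ <;> (simp [linChartSubst]; ring)

/-- **STEP 1, chart `z'` — NO top point**: `1 + z'·t·u″²w″²` has no prime of order `≥ 3` (`∂_t` gives `z'u″²w″² ∈
𝔮`, then `1 ∈ 𝔮`).
[new; elementary] [folklore] -/
theorem G0_B_chart_z_noTop (𝔮 : Ideal (MvPolynomial (Fin 4) K)) [𝔮.IsPrime] {s : MvPolynomial (Fin 4) K} (hs : s ∉ 𝔮)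
    (h : s * (1 + X 0 * X 1 * X 2 ^ 2 * X 3 ^ 2 : MvPolynomial (Fin 4) K) ∈ 𝔮 ^ 3) : False := by
  have hs2 : s ^ 2 ∉ 𝔮 := pow_not_mem 𝔮 hs 2
  have e10 := f_ne K (i := 1) (j := 0) (by decide)
  have e11 := f_self K 1
  have e12 := f_ne K (i := 1) (j := 2) (by decide)
  have e13 := f_ne K (i := 1) (j := 3) (by decide)
  have d1 : pderiv 1 (1 + X 0 * X 1 * X 2 ^ 2 * X 3 ^ 2 : MvPolynomial (Fin 4) K) = X 0 * X 2 ^ 2 * X 3 ^ 2 := by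
    simp only [map_add, Derivation.leibniz, Derivation.leibniz_pow, smul_eq_mul, nsmul_eq_mul, e10, e11, e12, e13, f_one]
    push_cast; ring
  have h1 := sq_mul_deriv_mem_pow 𝔮 h (pderiv 1)
  rw [d1] at h1
  have hm : (X 0 * X 2 ^ 2 * X 3 ^ 2 : MvPolynomial (Fin 4) K) ∈ 𝔮 :=
    (‹𝔮.IsPrime›.mem_or_mem (Ideal.pow_le_self two_ne_zero h1)).resolve_left hs2
  have hf : (1 + X 0 * X 1 * X 2 ^ 2 * X 3 ^ 2 : MvPolynomial (Fin 4) K) ∈ 𝔮 := mem_of_sMul_mem_cube 𝔮 hs h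
  have h1mem : (1 : MvPolynomial (Fin 4) K) ∈ 𝔮 := by
    have := Ideal.sub_mem _ hf (Ideal.mul_mem_left _ (X 1) hm)
    rwa [show (1 + X 0 * X 1 * X 2 ^ 2 * X 3 ^ 2 - X 1 * (X 0 * X 2 ^ 2 * X 3 ^ 2) : MvPolynomial (Fin 4) K) = 1 by ring] at this
  exact one_not_mem_of_isPrime 𝔮 h1mem

end GCertificatesC

end Summit.ResolutionOfSingularities.ResolutionOfSingularities.Theorems.DeltaCutClasses
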